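import Mathlib
import Literature.Analysis.FluidPDE.Tao2016AveragedNS.ShiftSetCascadeFlows
import Literature.Analysis.FluidPDE.Tao2016AveragedNS.ShiftSetCascadeFlux
import Summits.NavierStokesRegularity.NavierStokesRegularity.Theorems.TaoLadderRungTwoFlatCertificateGlueCheckerRowRemOn
import Summits.NavierStokesRegularity.NavierStokesRegularity.Theorems.TaoLadderRungTwoFlatCertificateGlueCheckerTrapOn
import HarnessLib

/-!
# Certificate glue on a shift set `𝕊`, XXIX-c: THE BRANCH CHECKER IN THE VECTOR LAYOUT — ONE Boolean test per vector-layout step record, the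
  definitional mesh `tOfV rec`, the transit test on the box, the start-node inclusion of a branch box, and the trapping clause `htrap` from checked
  transit branch chains (helper for items stmt-NavierStokesRegularity-22987 `FlatGapCertificatesV2` (crux K_A♭ of route TaoLadderRungTwoFlat) and
  stmt-24295 K_A₂(64); cell harvest/h2-tao-ladder, p1 g16; theory-1 A-73 / A-75: «with (i)–(iii) the WHOLE certificate (b = 0..9 and *) passes
  the transit test»)

Vector twin of glue XXIX / XXIX-b (`tOf`, `checkStepBox`, `stepCert_of_checkStepBox`, `transitBranch_of_checks`, `htrap_of_chainChecks`) over the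
records `VRec` of glue XXVIII-c with the per-row E-recursion of glue XXV-l / XXVIII-d (`stepCert_of_recVR`): `checkStepV rec j` = every test of
step `j` as ONE Boolean; `stepCert_of_checkStepV`; `hullBound_of_checkTransitV`
(glue XXIX's `checkTransit` on the record's own box); `node0_of_boxV` (identity start frame, nonnegative remainder vector); `transitBranchV_of_checks`;
`htrap_of_chainChecksV` = the clause `htrap` of glue IV VERBATIM from a finite family of checked transit branch chains and the cover of the fattened core
by the weighted start boxes.

HONEST FRAMING: Tao-type MODEL lattices (Tao 2016 §4/§6 vocabulary, shift-set parametrised); soundness of a checker — NO certificate instance exists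
in the tree, nothing is certified here, no stub is closed, nothing here is a statement about the Navier–Stokes equations.
-/

-- the sub-problem namespace repeats the summit name by design (D-0017)
set_option linter.dupNamespace false

namespace Summit.NavierStokesRegularity.NavierStokesRegularity.Theorems

open Set Finset Literature.Analysis.FluidPDE Literature.Analysis.FluidPDE.TaoCascade
open Summit.NavierStokesRegularity.NavierStokesRegularity.Theorems.TaylorModelCert
open Summit.NavierStokesRegularity.NavierStokesRegularity.Theorems.TaylorModelReadout

namespace CertificateGlueOn

variable {m : ℕ} {Kb Ka : ℤ}

/-! ### The definitional mesh -/

/-- The mesh DEFINED by the step lengths: `tOfV rec j = h 0 + ⋯ + h (j−1)`. [folklore] -/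
def tOfV (rec : ℕ → VRec) (j : ℕ) : ℝ := ∑ l ∈ Finset.range j, ((rec l).h : ℝ)

/-- `tOfV rec 0 = 0`. [folklore] -/
theorem tOfV_zero (rec : ℕ → VRec) : tOfV rec 0 = 0 := by simp [tOfV]

/-- `tOfV rec (j+1) − tOfV rec j = h j`. [folklore] -/
theorem tOfV_succ_sub (rec : ℕ → VRec) (j : ℕ) : tOfV rec (j + 1) - tOfV rec j = ((rec j).h : ℝ) := by
  simp [tOfV, Finset.sum_range_succ]

/-- A positive step length makes the mesh increase. [folklore] -/
theorem tOfV_lt_succ {rec : ℕ → VRec} {j : ℕ} (h : 0 < (rec j).h) : tOfV rec j < tOfV rec (j + 1) := by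
  have := tOfV_succ_sub rec j
  have h' : (0 : ℝ) < ((rec j).h : ℝ) := by exact_mod_cast h
  linarith

/-- The rational value of the mesh: `∑_{l<j} h l`. [folklore] -/
def sumHV (rec : ℕ → VRec) (j : ℕ) : ℚ := ∑ l ∈ Finset.range j, (rec l).h

/-- `c ≤ tOfV rec N` from the rational test `c ≤ sumHV rec N`. [folklore] -/
theorem le_tOfV_of_le_sumHV {rec : ℕ → VRec} {N : ℕ} {c : ℚ} (h : c ≤ sumHV rec N) : (c : ℝ) ≤ tOfV rec N := by
  have : tOfV rec N = ((sumHV rec N : ℚ) : ℝ) := by simp [tOfV, sumHV]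
  rw [this]; exact_mod_cast h

/-! ### The start node of a branch box -/

/-- Componentwise nonnegativity test of a dyadic vector. [folklore] -/
def checkNonneg (n : ℕ) (v : Array Dyad) : Bool := (List.range n).all fun c => Dyad.ble (Dyad.ofInt 0) (dgetD v c)

/-- **Start-node inclusion of a branch box**: a record starting with the identity frame and a nonnegative remainder vector contains every state whose
weighted coordinates lie within `r 0` of `x 0`. [folklore] -/
theorem node0_of_boxV {ωq : Fin m → ℤ → ℚ} {rec : ℕ → VRec} (hC : checkIdFrame (m * winLen Kb Ka) (rec 0).C = true)
    (hE : checkNonneg (m * winLen Kb Ka) (rec 0).E = true) {y : Fin m → ℤ → ℝ}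
    (hy : ∀ c, |pxcoord Kb Ka (fun i k => (ωq i k : ℝ)) y c - dvec (n := m * winLen Kb Ka) (rec 0).x c| ≤
      dvec (n := m * winLen Kb Ka) (rec 0).r c) :
    nodeOfV Kb Ka ωq rec 0 y := by
  unfold nodeOfV
  rw [dmat_eq_one_of_check hC]
  simp only [checkNonneg, List.all_eq_true, List.mem_range, Dyad.ble_iff, Dyad.toReal_ofInt, Int.cast_zero] at hE
  refine ⟨pxcoord Kb Ka (fun i k => (ωq i k : ℝ)) y - dvec (n := m * winLen Kb Ka) (rec 0).x, 0,
    fun c => by simpa using hy c, fun c => by simpa [dvec] using hE c c.isLt, ?_⟩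
  simp

/-! ### The transit test on the record's box -/

/-- **Hull states of a transit step stay in the open `M`-box** (glue XXIX `checkTransit` on the record's box). [folklore] -/
theorem hullBound_of_checkTransitV {shifts : List (ℤ × ℤ × ℤ)} (hnd : shifts.Nodup)
    {αq : Fin m → Fin m → Fin m → ℤ × ℤ × ℤ → ℚ} {ωq : Fin m → ℤ → ℚ} (hω : ∀ i k, 0 < ωq i k)
    {prec : ℕ} {Sp Sm : IntervalD} {rec : ℕ → VRec} {j : ℕ} {Mq : ℤ → ℚ} (hAA' : (rec j).A ≤ (rec j).A')
    (h13 : checkCoverV m Kb Ka shifts (coefBoxOf prec αq ωq Sp Sm) (rec j).x (rec j).ρ (rec j).E (rec j).lo (rec j).hi (rec j).h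
      (rec j).A' = true)
    (htr : checkTransit m Kb Ka ωq Mq (rec j).lo (rec j).hi = true)
    {y : Fin m → ℤ → ℝ} (hy : hullOfV Kb Ka shifts αq ωq prec Sp Sm rec j y) :
    ∀ i k, -Kb ≤ k → k ≤ Ka → |y i k| < (Mq k : ℝ) := by
  intro i k hk1 hk2
  have hw : -Kb ≤ k ∧ k ≤ Ka := ⟨hk1, hk2⟩
  have hb := hull_coord_boundsV hnd hω hAA' h13 hy i hw
  rw [idxOf_val i hw] at hb
  simp only [checkTransit, List.all_eq_true, List.mem_finRange, List.mem_range, Bool.and_eq_true, decide_eq_true_eq,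
    true_implies] at htr
  have hcc : (k + Kb).toNat < winLen Kb Ka := by
    unfold winLen; rw [Int.toNat_lt_toNat (by omega)]; omega
  obtain ⟨h1, h2⟩ := htr i (k + Kb).toNat hcc
  rw [Int.toNat_of_nonneg (by omega), show k + Kb - Kb = k by ring] at h1 h2
  have h1r := (Rat.cast_lt (K := ℝ)).mpr h1
  have h2r := (Rat.cast_lt (K := ℝ)).mpr h2
  simp only [Rat.cast_mul, Rat.cast_neg, cast_dyadToRat] at h1r h2r
  rw [abs_lt]
  exact ⟨by linarith [hb.1], by linarith [hb.2]⟩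

/-! ### One Boolean test per step -/

/-- **ALL TESTS OF VECTOR-LAYOUT STEP `j`** (signs, hand-over to record `j+1`, C2, C3v, hull radii, C6v, C8vr (per-row remainder), C9v, cover C13v, K-table,
defect table, Grönwall) as one Boolean. [folklore] -/
def checkStepV (m : ℕ) (Kb Ka : ℤ) (prec p kexp nexp : ℕ) (shifts : List (ℤ × ℤ × ℤ))
    (αq : Fin m → Fin m → Fin m → ℤ × ℤ × ℤ → ℚ) (ωq : Fin m → ℤ → ℚ) (Sp Sm : IntervalD) (bD : Dyad) (Eb Et : ℚ)
    (rec : ℕ → VRec) (j : ℕ) : Bool :=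
  let n := m * winLen Kb Ka
  let cB := coefBoxOf prec αq ωq Sp Sm
  let s := rec j
  let hI := ofRatRel prec s.h
  let JX := IntervalD.jetLevelsA n (pqBoxA Kb Ka prec shifts cB) prec (pointBoxA n s.x) p
  let JH := IntervalD.jetLevelsA n (pqBoxA Kb Ka prec shifts cB) prec (hullBoxA n s.x s.ρ s.E) p
  Dyad.ble (Dyad.ofInt 0) s.mC && Dyad.ble (Dyad.ofInt 0) s.ρs && decide (s.A < s.A') && decide (0 < s.h) &&
  checkHandsOverV n s (rec (j + 1)) &&
  checkAbsLe n s.x s.mC && checkRowsLe n s.C s.r s.ρ && checkHull n s.ρ s.E s.ρs && checkRowsLe n s.T s.r s.r' &&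
  checkERecVR m Kb Ka shifts cB p (dyadToRat bD) (dyadToRat s.mC) (dyadToRat s.ρs) s.h
    (dPArr n prec (IntervalD.polyLevelsA n prec JX p hI) s.x')
    (kappaArr prec n s.Cn s.T (vcolsA Kb Ka prec shifts cB p JH hI s.C) s.r)
    (nveArr n (IntervalD.polyLevelsA n prec (IntervalD.varJetLevelsA n (pqBoxA Kb Ka prec shifts cB) prec JH (symBoxA n s.E) p) p hI))
    s.E1 &&
  checkGuardV (dyadToRat bD) (dyadToRat s.mC) (dyadToRat s.ρs) s.h &&
  checkCoverV m Kb Ka shifts cB s.x s.ρ s.E s.lo s.hi s.h s.A' &&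
  checkLipT m Kb Ka shifts cB s.lo s.hi s.K &&
  checkDefectT m Kb Ka prec shifts αq ωq Eb Et s.lo s.hi Sp Sm s.δ &&
  checkGronwallK s.K (dyadToRat s.δ) s.h s.A kexp nexp

/-- **`StepCert` OF STEP `j` FROM THE TWO BOOLEANS** `checkGlobal` (glue XXIX) and `checkStepV … j`, on the definitional mesh `tOfV rec`.
[cite: Zgliczynski2002C1Lohner, §3–4 (Lohner-type parallelepiped frames and the C¹/variational enclosure); cell certificate format, branch checker, vector remainder] -/
theorem stepCert_of_checkStepV (hKb : 0 ≤ Kb) (hKa : 1 ≤ Ka) {shifts : List (ℤ × ℤ × ℤ)} (hnd : shifts.Nodup)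
    (h𝕊 : IsNearestNeighbourSet shifts.toFinset) {q : ℚ}
    {αq : Fin m → Fin m → Fin m → ℤ × ℤ × ℤ → ℚ} {ωq : Fin m → ℤ → ℚ} (hω : ∀ i k, 0 < ωq i k)
    {prec p kexp nexp : ℕ} {Sp Sm : IntervalD} {bD : Dyad} {Eb Et : ℚ} {M : ℤ → ℝ} {rec : ℕ → VRec} {j : ℕ}
    (hg : checkGlobal m Kb Ka prec shifts αq ωq q Sp Sm bD = true)
    (hs : checkStepV m Kb Ka prec p kexp nexp shifts αq ωq Sp Sm bD Eb Et rec j = true) :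
    StepCert shifts.toFinset (q : ℝ) (fun i₁ i₂ i μ => (αq i₁ i₂ i μ : ℝ)) Kb Ka (Eb : ℝ) (Et : ℝ) M (tOfV rec)
      (nodeOfV Kb Ka ωq rec) (hullOfV Kb Ka shifts αq ωq prec Sp Sm rec) j := by
  simp only [checkGlobal, Bool.and_eq_true, decide_eq_true_eq, Dyad.ble_iff, Dyad.toReal_ofInt, Int.cast_zero] at hg
  obtain ⟨⟨⟨⟨hSp, hSm⟩, hq⟩, hb⟩, hchkB⟩ := hg
  simp only [checkStepV, Bool.and_eq_true, decide_eq_true_eq, Dyad.ble_iff, Dyad.toReal_ofInt, Int.cast_zero] at hs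
  obtain ⟨⟨⟨⟨⟨⟨⟨⟨⟨⟨⟨⟨⟨⟨hmC, hρs⟩, hAA'⟩, hh⟩, hho⟩, h2⟩, h3⟩, hhull⟩, h6⟩, h8⟩, h9⟩, h13⟩, h10⟩, h11⟩, h12⟩ := hs
  have hq' : 0 < 1 + (q : ℝ) := by
    have : ((-1 : ℚ) : ℝ) < (q : ℝ) := by exact_mod_cast hq
    push_cast at this; linarith
  exact stepCert_of_recVR hKb hKa hnd h𝕊 hq' hω hSp hSm hb hmC hρs hAA' (tOfV_succ_sub rec j) hho hchkB h2 h3 hhull h6 h8 h9 h13 h10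
    h11 h12

/-- **THE PER-BRANCH PACKAGE FOR A TRANSIT BRANCH (VECTOR LAYOUT)**: tests of steps `0 … N−1` and their transit tests ⇒ the mesh facts `ht0`, `hmono`,
the step certificates `hstep` and the hull bound `hhull` of glue XXII `htrap_of_branchMeshes` for this branch. [folklore] -/
theorem transitBranchV_of_checks (hKb : 0 ≤ Kb) (hKa : 1 ≤ Ka) {shifts : List (ℤ × ℤ × ℤ)} (hnd : shifts.Nodup)
    (h𝕊 : IsNearestNeighbourSet shifts.toFinset) {q : ℚ}
    {αq : Fin m → Fin m → Fin m → ℤ × ℤ × ℤ → ℚ} {ωq : Fin m → ℤ → ℚ} (hω : ∀ i k, 0 < ωq i k)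
    {prec p kexp nexp : ℕ} {Sp Sm : IntervalD} {bD : Dyad} {Eb Et : ℚ} {Mq : ℤ → ℚ} {rec : ℕ → VRec} {N : ℕ}
    (hg : checkGlobal m Kb Ka prec shifts αq ωq q Sp Sm bD = true)
    (hs : ∀ j, j < N → checkStepV m Kb Ka prec p kexp nexp shifts αq ωq Sp Sm bD Eb Et rec j = true)
    (htr : ∀ j, j < N → checkTransit m Kb Ka ωq Mq (rec j).lo (rec j).hi = true) :
    tOfV rec 0 = 0 ∧ (∀ j, j < N → tOfV rec j < tOfV rec (j + 1)) ∧
    (∀ j, j < N → StepCert shifts.toFinset (q : ℝ) (fun i₁ i₂ i μ => (αq i₁ i₂ i μ : ℝ)) Kb Ka (Eb : ℝ) (Et : ℝ)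
      (fun k => (Mq k : ℝ)) (tOfV rec) (nodeOfV Kb Ka ωq rec) (hullOfV Kb Ka shifts αq ωq prec Sp Sm rec) j) ∧
    (∀ j, j < N → ∀ y, hullOfV Kb Ka shifts αq ωq prec Sp Sm rec j y → ∀ i k, -Kb ≤ k → k ≤ Ka → |y i k| < (Mq k : ℝ)) := by
  refine ⟨tOfV_zero rec, fun j hj => ?_, fun j hj => stepCert_of_checkStepV hKb hKa hnd h𝕊 hω hg (hs j hj), fun j hj y hy => ?_⟩
  · have h := hs j hj
    simp only [checkStepV, Bool.and_eq_true, decide_eq_true_eq] at h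
    exact tOfV_lt_succ h.1.1.1.1.1.1.1.1.1.1.1.2
  · have h := hs j hj
    simp only [checkStepV, Bool.and_eq_true, decide_eq_true_eq] at h
    have hAA' : (rec j).A ≤ (rec j).A' := le_of_lt h.1.1.1.1.1.1.1.1.1.1.1.1.2
    exact hullBound_of_checkTransitV hnd hω hAA' h.1.1.1.2 (htr j hj) hy

/-! ### The trapping clause from checked transit branch chains -/

variable {ι : Type*} {Core : (Fin m → ℤ → ℝ) → Prop} {w : ℤ → ℝ} {r : ℝ}

/-- **THE TRAPPING CLAUSE `htrap` FROM CHECKED TRANSIT BRANCH CHAINS (VECTOR LAYOUT).** Per branch `b`: records `rec b`, `N b` steps with `checkStepV`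
and `checkTransit` passing, the clock `c ≤ Σ_{j<N b} h`, the start frame the identity with a nonnegative remainder vector; globally `checkGlobal`; and
the fattened core covered by the weighted start boxes ⇒ `htrap` (open `M`-box `M k = Mq k`, clock `c`, edge bounds `Eb`, `Et`).
[cite: Tao2016AveragedNS, §6.3–6.4 Props. 6.4–6.5 (statement shape of a renormalisation certificate); cell certificate format, branch checker, vector remainder] -/
theorem htrap_of_chainChecksV (hKb : 0 ≤ Kb) (hKa : 1 ≤ Ka) {shifts : List (ℤ × ℤ × ℤ)} (hnd : shifts.Nodup)
    (h𝕊 : IsNearestNeighbourSet shifts.toFinset) {q : ℚ}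
    {αq : Fin m → Fin m → Fin m → ℤ × ℤ × ℤ → ℚ} {ωq : Fin m → ℤ → ℚ} (hω : ∀ i k, 0 < ωq i k)
    {prec p kexp nexp : ℕ} {Sp Sm : IntervalD} {bD : Dyad} {Eb Et c : ℚ} {Mq : ℤ → ℚ}
    {rec : ι → ℕ → VRec} {N : ι → ℕ}
    (hg : checkGlobal m Kb Ka prec shifts αq ωq q Sp Sm bD = true)
    (hs : ∀ b j, j < N b → checkStepV m Kb Ka prec p kexp nexp shifts αq ωq Sp Sm bD Eb Et (rec b) j = true)
    (htr : ∀ b j, j < N b → checkTransit m Kb Ka ωq Mq (rec b j).lo (rec b j).hi = true)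
    (hc : ∀ b, c ≤ sumHV (rec b) (N b))
    (hid : ∀ b, checkIdFrame (m * winLen Kb Ka) (rec b 0).C = true) (hE : ∀ b, checkNonneg (m * winLen Kb Ka) (rec b 0).E = true)
    (hcover : ∀ (z S₀ : Fin m → ℤ → ℝ), Core z → (∀ i k, -Kb ≤ k → k ≤ Ka → w k * |S₀ i k - z i k| ≤ r) →
      ∃ b, ∀ d, |pxcoord Kb Ka (fun i k => (ωq i k : ℝ)) S₀ d - dvec (n := m * winLen Kb Ka) (rec b 0).x d| ≤
        dvec (n := m * winLen Kb Ka) (rec b 0).r d) :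
    ∀ (s : ℝ) (z : Fin m → ℤ → ℝ) (S : Fin m → ℤ → ℝ → ℝ), Core z → 0 < s → s ≤ (c : ℝ) →
      (∀ i k, -Kb ≤ k → k ≤ Ka → w k * |S i k 0 - z i k| ≤ r) →
      (∀ i k, -Kb ≤ k → k ≤ Ka → ∀ u ∈ Icc 0 s,
        HasDerivWithinAt (S i k) (quadTermOn shifts.toFinset (q : ℝ) (fun i₁ i₂ i μ => (αq i₁ i₂ i μ : ℝ)) S i k u) (Icc 0 s) u) →
      (∀ i, ContinuousOn (S i (-Kb - 1)) (Icc 0 s)) → (∀ i, ContinuousOn (S i (Ka + 1)) (Icc 0 s)) →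
      (∀ i, ∀ u ∈ Icc 0 s, |S i (-Kb - 1) u| ≤ (Eb : ℝ)) →
      (∀ i, ∀ u ∈ Icc 0 s, |S i (Ka + 1) u| ≤ (Et : ℝ)) →
      (∀ i k, -Kb ≤ k → k ≤ Ka → ∀ u ∈ Icc 0 s, |S i k u| ≤ (Mq k : ℝ)) →
        ∀ i k, -Kb ≤ k → k ≤ Ka → ∀ u ∈ Icc 0 s, |S i k u| < (Mq k : ℝ) := by
  have hbr := fun b => transitBranchV_of_checks hKb hKa hnd h𝕊 hω hg (hs b) (htr b)
  exact htrap_of_branchMeshes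
    (Box := fun b S₀ => ∀ d, |pxcoord Kb Ka (fun i k => (ωq i k : ℝ)) S₀ d - dvec (n := m * winLen Kb Ka) (rec b 0).x d| ≤
      dvec (n := m * winLen Kb Ka) (rec b 0).r d)
    (t := fun b => tOfV (rec b)) (Node := fun b => nodeOfV Kb Ka ωq (rec b))
    (Hull := fun b => hullOfV Kb Ka shifts αq ωq prec Sp Sm (rec b))
    hcover (fun b => (hbr b).1) (fun b => (hbr b).2.1) (fun b => le_tOfV_of_le_sumHV (hc b))
    (fun b y hy => node0_of_boxV (hid b) (hE b) hy) (fun b => (hbr b).2.2.1) (fun b => (hbr b).2.2.2)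

end CertificateGlueOn

end Summit.NavierStokesRegularity.NavierStokesRegularity.Theorems
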